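import Literature.NumberTheory.Rogawski1990.AdelicStableOrbitalEulerLocalH
import Literature.NumberTheory.Automorphic.UnramifiedOrbitalUnitFactorPair
import HarnessLib

/-!
# The `H`-side Euler discharge ON AN UNRAMIFIED PURE TENSOR `f^H = f^H_∞ ⊗ ⊗_v f^H_v`: a finite set `S₁` beyond which every `S` gives
# `Σ_{𝒞′_𝐀(γ_H)} Φ_m(δ, f^H) = Φ^st_{H,∞}(γ_H ⊗ 1, f^H_∞) · ∏_{v ∈ S} Φ^st_{H,v}((γ_H)_v, f^H_v)` — modulo ONLY the Euler factorisation of the adelic family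
(Rogawski (1990), §4.3 p. 44, §5.4 (5.4.3) pp. 72–73; Kottwitz (1986) Prop. 7.1, Cor. 7.3)

Topic `NumberTheory/Rogawski1990`; namespace `Literature.NumberTheory.Rogawski1990`; THEOREMS ONLY (no definition, no instance, no named fact, no `sorry`).  Cell
`pub/hodgecm-mathlib`, ENGINE T1, ED 1.19c (xiii″) — the `H`-twin (E3c-H₀) of F0P3a-p01's (E3c) `MatchingAdeleG.exists_isEulerOnClasses_ofLocalAdelic`, for the pure
tensors ★ `UnitaryGroup.PureTensor₂ L Φ₂ Φ₁` (`Rogawski1990/TestFunctionsPair`) of `H(𝐀) = U(Φ₂)(𝔸) × U(Φ₁)(𝔸)`.  It assembles ★ (E3b-H)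
`MatchingAdeleH.isEulerOnClasses_of_factor_of_tsupport` with the pure-tensor bookkeeping: off `T.S` the local factor IS `1_{K₂,v × K₁,v}` (★ `PureTensor₂.loc_eq_indicator`,
★ `IsUnramified₂`), so it is supported in `{h | h.1 ∈ K₂,v}` and compactly supported (★ `isCompact_isOpen_prod_cmLocalIntegralLevel`); the unit factors `Φ_{H,v}([(γ_H)_v], f^H_v) = 1`
off a finite set are taken in the ∃-shape ★ (S-H) `exists_finset_forall_classOrbitalIntegral_loc_rationalComponent_eq_one` delivers (`h1`); the [Kt₄] Prop. 7.1 clause in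
the `∀ᶠ`-shape of ★ `AdelicStableOrbitalSupportFiniteH`'s `hP` (a theorem by ★ `eventually_forall_integralConj_cmDatum` at `N = 2`); the Euler FACTORISATION of
`Φ_m(c, f^H)` on `𝒞′_𝐀(γ_H)` stays the hypothesis `hfac` (the `H`-side adelic-family-from-local-families brick «C-H» delivers it for `m := prodOfLocalAdelic mH mHi`,
`f^H := T.eval`).

* `pureTensor₂_tsupport_loc_subset_of_not_mem`, `pureTensor₂_hasCompactSupport_loc_of_not_mem` — off `T.S` (unramified `T`).
* **`MatchingAdeleH.exists_isEulerOnClasses_of_factor_pureTensor`** — `∃ S₁, ∀ S ⊇ S₁, IsEulerOnClasses (𝒞′_𝐀(γ_H)) m f^H S (v ↦ Φ^st_{H,v}((γ_H)_v, T.loc v; mH v))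
  (Φ^st_{H,∞}(γ_H ⊗ 1, T.arch; mHi))`.

HC_CM is proved only modulo the printed citations until rung 0 closes; this file is unconditional.

## References
* J. D. Rogawski, *Automorphic Representations of Unitary Groups in Three Variables*, Ann. of Math. Stud. 123 (1990), §4.3 p. 44, §4.9 p. 54, §5.4 (5.4.3) pp. 72–73
  [Rogawski1990].
* R. E. Kottwitz, *Stable trace formula: elliptic singular terms*, Math. Ann. 275 (1986), Prop. 7.1, Cor. 7.3 [Kottwitz1986].
-/

noncomputable section

open NumberField IsDedekindDomain Filter Function MeasureTheory
open scoped MatrixGroups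

namespace Literature.NumberTheory.Rogawski1990

open Literature.NumberTheory.Automorphic Literature.NumberTheory.Automorphic.UnitaryGroup
open Literature.AlgebraicGeometry.ShimuraVarieties (unitaryGroup)

section PureTensorH

variable {L : Type} [Field L] [NumberField L] [IsCMField L]

/-! ## §1 Off the bad set the local factor of an unramified pure tensor is supported in `K₂,v × K₁,v` -/

/-- **Off `T.S`, `tsupport (T.loc v) ⊆ {h | h.1 ∈ K₂,v}`** for an UNRAMIFIED pure tensor on `U(H₂)(𝔸) × U(H₁)(𝔸)`: there `T.loc v = 1_{K₂,v × K₁,v}` (★ `loc_eq_indicator`,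
★ `IsUnramified₂`) and `K₂,v × K₁,v` is compact (★ `isCompact_isOpen_prod_cmLocalIntegralLevel`), hence closed. [cite: Rogawski1990, §4.9 p. 54] -/
theorem pureTensor₂_tsupport_loc_subset_of_not_mem {N₂ N₁ : ℕ} {H₂ : Matrix (Fin N₂) (Fin N₂) L} {H₁ : Matrix (Fin N₁) (Fin N₁) L}
    (T : PureTensor₂ L H₂ H₁) (hT : T.IsUnramified₂) {v : HeightOneSpectrum (𝓞 ↥(maximalRealSubfield L))} (hv : v ∉ T.S) :
    tsupport (T.loc v) ⊆ {h : (cmDatum L N₂ H₂).Local v × (cmDatum L N₁ H₁).Local v | h.1 ∈ cmLocalIntegralLevel L N₂ H₂ v} := by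
  rw [T.loc_eq_indicator v hv, (hT v hv).1, (hT v hv).2]
  refine (closure_minimal Set.support_indicator_subset (isCompact_isOpen_prod_cmLocalIntegralLevel L H₂ H₁ v).1.isClosed).trans ?_
  intro h hh
  exact hh.1

/-- **Off `T.S`, `T.loc v` has compact support** (it vanishes off the compact `K₂,v × K₁,v`). [cite: Rogawski1990, §4.9 p. 54] -/
theorem pureTensor₂_hasCompactSupport_loc_of_not_mem {N₂ N₁ : ℕ} {H₂ : Matrix (Fin N₂) (Fin N₂) L} {H₁ : Matrix (Fin N₁) (Fin N₁) L}
    (T : PureTensor₂ L H₂ H₁) (hT : T.IsUnramified₂) {v : HeightOneSpectrum (𝓞 ↥(maximalRealSubfield L))} (hv : v ∉ T.S) :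
    HasCompactSupport (T.loc v) := by
  rw [T.loc_eq_indicator v hv, (hT v hv).1, (hT v hv).2]
  exact HasCompactSupport.intro' (isCompact_isOpen_prod_cmLocalIntegralLevel L H₂ H₁ v).1
    (isCompact_isOpen_prod_cmLocalIntegralLevel L H₂ H₁ v).1.isClosed fun x hx => Set.indicator_of_notMem hx _

/-! ## §2 The `H`-side Euler discharge on an unramified pure tensor -/

variable {γH : (UnitaryGroup.cmDatum L 2 (Matrix.of fun i j : Fin 2 => if i.val + j.val + 1 = 2 then (1 : L) else 0)).Rational ×
  (UnitaryGroup.cmDatum L 1 (Matrix.of fun i j : Fin 1 => if i.val + j.val + 1 = 1 then (1 : L) else 0)).Rational}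
variable
  [∀ (v : HeightOneSpectrum (𝓞 ↥(maximalRealSubfield L))) (a : ((UnitaryGroup.cmDatum L 2 (Matrix.of fun i j : Fin 2 => if i.val + j.val + 1 = 2 then (1 : L) else 0)).Local v ×
        (UnitaryGroup.cmDatum L 1 (Matrix.of fun i j : Fin 1 => if i.val + j.val + 1 = 1 then (1 : L) else 0)).Local v)),
    MeasurableSpace (((UnitaryGroup.cmDatum L 2 (Matrix.of fun i j : Fin 2 => if i.val + j.val + 1 = 2 then (1 : L) else 0)).Local v ×
        (UnitaryGroup.cmDatum L 1 (Matrix.of fun i j : Fin 1 => if i.val + j.val + 1 = 1 then (1 : L) else 0)).Local v) ⧸ Subgroup.centralizer ({a} : Set ((UnitaryGroup.cmDatum L 2 (Matrix.of fun i j : Fin 2 => if i.val + j.val + 1 = 2 then (1 : L) else 0)).Local v ×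
        (UnitaryGroup.cmDatum L 1 (Matrix.of fun i j : Fin 1 => if i.val + j.val + 1 = 1 then (1 : L) else 0)).Local v)))]
  [∀ h : (UnitaryGroup.cmDatum L 2 (Matrix.of fun i j : Fin 2 => if i.val + j.val + 1 = 2 then (1 : L) else 0)).Adelic ×
      (UnitaryGroup.cmDatum L 1 (Matrix.of fun i j : Fin 1 => if i.val + j.val + 1 = 1 then (1 : L) else 0)).Adelic,
    MeasurableSpace (((UnitaryGroup.cmDatum L 2 (Matrix.of fun i j : Fin 2 => if i.val + j.val + 1 = 2 then (1 : L) else 0)).Adelic ×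
      (UnitaryGroup.cmDatum L 1 (Matrix.of fun i j : Fin 1 => if i.val + j.val + 1 = 1 then (1 : L) else 0)).Adelic) ⧸
      Subgroup.centralizer ({h} : Set ((UnitaryGroup.cmDatum L 2 (Matrix.of fun i j : Fin 2 => if i.val + j.val + 1 = 2 then (1 : L) else 0)).Adelic ×
        (UnitaryGroup.cmDatum L 1 (Matrix.of fun i j : Fin 1 => if i.val + j.val + 1 = 1 then (1 : L) else 0)).Adelic)))]
  [∀ a : (↥(UnitaryGroup.arch (↥(maximalRealSubfield L)) L (IsCMField.complexConj L) 2
        (Matrix.of fun i j : Fin 2 => if i.val + j.val + 1 = 2 then (1 : L) else 0)) ×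
      ↥(UnitaryGroup.arch (↥(maximalRealSubfield L)) L (IsCMField.complexConj L) 1
        (Matrix.of fun i j : Fin 1 => if i.val + j.val + 1 = 1 then (1 : L) else 0))),
    MeasurableSpace ((↥(UnitaryGroup.arch (↥(maximalRealSubfield L)) L (IsCMField.complexConj L) 2
        (Matrix.of fun i j : Fin 2 => if i.val + j.val + 1 = 2 then (1 : L) else 0)) ×
      ↥(UnitaryGroup.arch (↥(maximalRealSubfield L)) L (IsCMField.complexConj L) 1
        (Matrix.of fun i j : Fin 1 => if i.val + j.val + 1 = 1 then (1 : L) else 0))) ⧸ Subgroup.centralizer ({a} : Set (↥(UnitaryGroup.arch (↥(maximalRealSubfield L)) L (IsCMField.complexConj L) 2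
        (Matrix.of fun i j : Fin 2 => if i.val + j.val + 1 = 2 then (1 : L) else 0)) ×
      ↥(UnitaryGroup.arch (↥(maximalRealSubfield L)) L (IsCMField.complexConj L) 1
        (Matrix.of fun i j : Fin 1 => if i.val + j.val + 1 = 1 then (1 : L) else 0)))))]

/-- **THE `H`-SIDE EULER DISCHARGE ON AN UNRAMIFIED PURE TENSOR, modulo the Euler factorisation of the adelic family.**  `H = U(Φ₂) × U(Φ₁)`, `γ_H = (γ₂, γ₁)`
rational `G`-regular (★ `IsGRegular`); local class-indexed families `mH v` on `H_v` and an archimedean family `mHi`; an unramified pure tensor `T` (★ `PureTensor₂`,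
`T.IsUnramified₂`) with compactly supported factors at the bad places and at `∞`; an adelic family `m` on `H(𝐀)` and a function `f^H` whose class orbital integrals
FACTOR on `𝒞′_𝐀(γ_H)` through `(mH, T.loc, mHi, T.arch)` in the finite-set shape (`hfac` — for `m := prodOfLocalAdelic mH mHi`, `f^H := T.eval` this is the Euler
product of the «C-H» brick); the unit factors `Φ_{mH v}([(γ_H)_v], T.loc v) = 1` off a finite set (`h1` — ★ (S-H) `exists_finset_forall_classOrbitalIntegral_loc_rationalComponent_eq_one`);
and the a.e. `K_v`-conjugacy of [Kt₄] Prop. 7.1 for `U(Φ₂)` at `γ₂` (`hP` — ★ `AdelicStableOrbitalSupportFiniteH`'s shape, a theorem by ★ `eventually_forall_integralConj_cmDatum`).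
THEN there is a finite `S₁` such that for every finite `S ⊇ S₁`:
`IsEulerOnClasses (𝒞′_𝐀(γ_H)) m f^H S (v ↦ Φ^st_{H,v}((γ_H)_v, T.loc v; mH v)) (Φ^st_{H,∞}(γ_H ⊗ 1, T.arch; mHi))` — `Σ_{δ ∈ 𝒞′_𝐀(γ_H)} Φ_m(δ, f^H) = Φ^st_{H,∞} · ∏_{v ∈ S} Φ^st_{H,v}`
with the `H`-side stable orbital integrals spelled as in ★ `IsLocalDeltaTransfer` ∕ ★ `IsArchDeltaTransfer`. [cite: Rogawski1990, §4.3 p. 44; §5.4 (5.4.3) pp. 72–73]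
[cite: Kottwitz1986, Prop. 7.1, Cor. 7.3] -/
theorem MatchingAdeleH.exists_isEulerOnClasses_of_factor_pureTensor
    (hreg : IsGRegular (cmConjRingHom L) (Matrix.of fun i j : Fin 2 => if i.val + j.val + 1 = 2 then (1 : L) else 0)
      (Matrix.of fun i j : Fin 1 => if i.val + j.val + 1 = 1 then (1 : L) else 0) (Matrix.of fun i j : Fin 3 => if i.val + j.val + 1 = 3 then (1 : L) else 0)
      endoForm_antidiagOne γH)
    (mA : OrbitalMeasureFamily ((UnitaryGroup.cmDatum L 2 (Matrix.of fun i j : Fin 2 => if i.val + j.val + 1 = 2 then (1 : L) else 0)).Adelic ×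
      (UnitaryGroup.cmDatum L 1 (Matrix.of fun i j : Fin 1 => if i.val + j.val + 1 = 1 then (1 : L) else 0)).Adelic))
    (fH : (UnitaryGroup.cmDatum L 2 (Matrix.of fun i j : Fin 2 => if i.val + j.val + 1 = 2 then (1 : L) else 0)).Adelic ×
      (UnitaryGroup.cmDatum L 1 (Matrix.of fun i j : Fin 1 => if i.val + j.val + 1 = 1 then (1 : L) else 0)).Adelic → ℂ)
    (mH : ∀ v : HeightOneSpectrum (𝓞 ↥(maximalRealSubfield L)), OrbitalMeasureFamily ((UnitaryGroup.cmDatum L 2 (Matrix.of fun i j : Fin 2 => if i.val + j.val + 1 = 2 then (1 : L) else 0)).Local v ×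
        (UnitaryGroup.cmDatum L 1 (Matrix.of fun i j : Fin 1 => if i.val + j.val + 1 = 1 then (1 : L) else 0)).Local v))
    (mHi : OrbitalMeasureFamily (↥(UnitaryGroup.arch (↥(maximalRealSubfield L)) L (IsCMField.complexConj L) 2
        (Matrix.of fun i j : Fin 2 => if i.val + j.val + 1 = 2 then (1 : L) else 0)) ×
      ↥(UnitaryGroup.arch (↥(maximalRealSubfield L)) L (IsCMField.complexConj L) 1
        (Matrix.of fun i j : Fin 1 => if i.val + j.val + 1 = 1 then (1 : L) else 0))))
    (T : PureTensor₂ L (Matrix.of fun i j : Fin 2 => if i.val + j.val + 1 = 2 then (1 : L) else 0)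
      (Matrix.of fun i j : Fin 1 => if i.val + j.val + 1 = 1 then (1 : L) else 0))
    (hT : T.IsUnramified₂) (hTc : ∀ v ∈ T.S, HasCompactSupport (T.loc v)) (hTa : HasCompactSupport T.arch)
    (hP : ∀ᶠ v in cofinite, ∀ g : (UnitaryGroup.cmDatum L 2 (Matrix.of fun i j : Fin 2 => if i.val + j.val + 1 = 2 then (1 : L) else 0)).Local v,
      g ∈ UnitaryGroup.cmLocalIntegralLevel L 2 (Matrix.of fun i j : Fin 2 => if i.val + j.val + 1 = 2 then (1 : L) else 0) v →
        IsStablyConj (UnitaryGroup.conjLocal L (IsCMField.complexConj L) v) ((UnitaryGroup.adelicForm L 2 (Matrix.of fun i j : Fin 2 => if i.val + j.val + 1 = 2 then (1 : L) else 0)).map (UnitaryGroup.adeleToLocal L v))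
            ((UnitaryGroup.cmDatum L 2 (Matrix.of fun i j : Fin 2 => if i.val + j.val + 1 = 2 then (1 : L) else 0)).toLocal v ((UnitaryGroup.cmDatum L 2 (Matrix.of fun i j : Fin 2 => if i.val + j.val + 1 = 2 then (1 : L) else 0)).toAdelic γH.1)) g →
          ∃ k ∈ UnitaryGroup.cmLocalIntegralLevel L 2 (Matrix.of fun i j : Fin 2 => if i.val + j.val + 1 = 2 then (1 : L) else 0) v,
            k * (UnitaryGroup.cmDatum L 2 (Matrix.of fun i j : Fin 2 => if i.val + j.val + 1 = 2 then (1 : L) else 0)).toLocal v ((UnitaryGroup.cmDatum L 2 (Matrix.of fun i j : Fin 2 => if i.val + j.val + 1 = 2 then (1 : L) else 0)).toAdelic γH.1) * k⁻¹ = g)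
    (hfac : ∀ c ∈ adelicStableClassesOverH L γH, ∃ S₂ : Finset (HeightOneSpectrum (𝓞 ↥(maximalRealSubfield L))),
      (∀ v ∉ S₂, classOrbitalIntegral (mH v) (T.loc v) (ConjClasses.mk (MonoidHom.prodMap ((UnitaryGroup.cmDatum L 2 (Matrix.of fun i j : Fin 2 => if i.val + j.val + 1 = 2 then (1 : L) else 0)).toLocal v) ((UnitaryGroup.cmDatum L 1 (Matrix.of fun i j : Fin 1 => if i.val + j.val + 1 = 1 then (1 : L) else 0)).toLocal v) (Quotient.out c))) = 1) ∧
      classOrbitalIntegral mA fH c =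
        classOrbitalIntegral mHi T.arch (ConjClasses.mk (MonoidHom.prodMap
          (UnitaryGroup.archPart (↥(maximalRealSubfield L)) L (IsCMField.complexConj L) 2
            (Matrix.of fun i j : Fin 2 => if i.val + j.val + 1 = 2 then (1 : L) else 0))
          (UnitaryGroup.archPart (↥(maximalRealSubfield L)) L (IsCMField.complexConj L) 1
            (Matrix.of fun i j : Fin 1 => if i.val + j.val + 1 = 1 then (1 : L) else 0)) (Quotient.out c))) *
        ∏ v ∈ S₂, classOrbitalIntegral (mH v) (T.loc v) (ConjClasses.mk (MonoidHom.prodMap ((UnitaryGroup.cmDatum L 2 (Matrix.of fun i j : Fin 2 => if i.val + j.val + 1 = 2 then (1 : L) else 0)).toLocal v) ((UnitaryGroup.cmDatum L 1 (Matrix.of fun i j : Fin 1 => if i.val + j.val + 1 = 1 then (1 : L) else 0)).toLocal v) (Quotient.out c))))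
    (h1 : ∃ S₂ : Finset (HeightOneSpectrum (𝓞 ↥(maximalRealSubfield L))),
      ∀ v, v ∉ S₂ → classOrbitalIntegral (mH v) (T.loc v) (ConjClasses.mk (rationalComponent L γH v)) = 1) :
    ∃ S₁ : Finset (HeightOneSpectrum (𝓞 ↥(maximalRealSubfield L))), ∀ S : Finset (HeightOneSpectrum (𝓞 ↥(maximalRealSubfield L))), S₁ ⊆ S →
      IsEulerOnClasses (adelicStableClassesOverH L γH) mA fH S
        (fun v => stableOrbitalIntegralRel (G := ((UnitaryGroup.cmDatum L 2 (Matrix.of fun i j : Fin 2 => if i.val + j.val + 1 = 2 then (1 : L) else 0)).Local v ×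
          (UnitaryGroup.cmDatum L 1 (Matrix.of fun i j : Fin 1 => if i.val + j.val + 1 = 1 then (1 : L) else 0)).Local v)) (IsLocalStablyConjH L v) (mH v) (T.loc v)
          (rationalComponent L γH v))
        (stableOrbitalIntegralRel (G := (↥(UnitaryGroup.arch (↥(maximalRealSubfield L)) L (IsCMField.complexConj L) 2
          (Matrix.of fun i j : Fin 2 => if i.val + j.val + 1 = 2 then (1 : L) else 0)) ×
        ↥(UnitaryGroup.arch (↥(maximalRealSubfield L)) L (IsCMField.complexConj L) 1
          (Matrix.of fun i j : Fin 1 => if i.val + j.val + 1 = 1 then (1 : L) else 0)))) (IsArchStablyConjH L) mHi T.arch (rationalArch L γH)) := by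
  classical
  -- the bad places of [Kt₄] 7.1 and of the unit factors
  have hPfin := Filter.eventually_cofinite.1 hP
  obtain ⟨S₂, hS₂⟩ := h1
  refine ⟨T.S ∪ hPfin.toFinset ∪ S₂, fun S hS => ?_⟩
  have hS_T : ∀ v ∉ S, v ∉ T.S := fun v hv h => hv (hS (Finset.mem_union_left _ (Finset.mem_union_left _ h)))
  have hS_P : ∀ v ∉ S, ∀ g : (UnitaryGroup.cmDatum L 2 (Matrix.of fun i j : Fin 2 => if i.val + j.val + 1 = 2 then (1 : L) else 0)).Local v,
      g ∈ UnitaryGroup.cmLocalIntegralLevel L 2 (Matrix.of fun i j : Fin 2 => if i.val + j.val + 1 = 2 then (1 : L) else 0) v →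
        IsStablyConj (UnitaryGroup.conjLocal L (IsCMField.complexConj L) v) ((UnitaryGroup.adelicForm L 2 (Matrix.of fun i j : Fin 2 => if i.val + j.val + 1 = 2 then (1 : L) else 0)).map (UnitaryGroup.adeleToLocal L v))
            ((UnitaryGroup.cmDatum L 2 (Matrix.of fun i j : Fin 2 => if i.val + j.val + 1 = 2 then (1 : L) else 0)).toLocal v ((UnitaryGroup.cmDatum L 2 (Matrix.of fun i j : Fin 2 => if i.val + j.val + 1 = 2 then (1 : L) else 0)).toAdelic γH.1)) g →
          ∃ k ∈ UnitaryGroup.cmLocalIntegralLevel L 2 (Matrix.of fun i j : Fin 2 => if i.val + j.val + 1 = 2 then (1 : L) else 0) v,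
            k * (UnitaryGroup.cmDatum L 2 (Matrix.of fun i j : Fin 2 => if i.val + j.val + 1 = 2 then (1 : L) else 0)).toLocal v ((UnitaryGroup.cmDatum L 2 (Matrix.of fun i j : Fin 2 => if i.val + j.val + 1 = 2 then (1 : L) else 0)).toAdelic γH.1) * k⁻¹ = g := by
    intro v hv
    by_contra hnot
    exact hv (hS (Finset.mem_union_left _ (Finset.mem_union_right _ (hPfin.mem_toFinset.2 hnot))))
  have hS_1 : ∀ v ∉ S, classOrbitalIntegral (mH v) (T.loc v) (ConjClasses.mk (rationalComponent L γH v)) = 1 :=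
    fun v hv => hS₂ v fun h => hv (hS (Finset.mem_union_right _ h))
  refine MatchingAdeleH.isEulerOnClasses_of_factor_of_tsupport hreg mA fH mH T.loc mHi T.arch S hS_P hfac hS_1
    (fun v hv => pureTensor₂_tsupport_loc_subset_of_not_mem T hT (hS_T v hv)) (fun v _ => ?_) hTa
  by_cases hvT : v ∈ T.S
  · exact hTc v hvT
  · exact pureTensor₂_hasCompactSupport_loc_of_not_mem T hT hvT

end PureTensorH

end Literature.NumberTheory.Rogawski1990

end
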